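import Mathlib
import HarnessLib
import HarnessLib.Audit
import Summits.Langlands.Statement
import Literature.NumberTheory.Automorphic.LocalLanglandsGLProofs
import Literature.NumberTheory.Automorphic.LocalConstantsProofs
import Literature.NumberTheory.GaloisRepresentations.LocalGaloisGroupProofs
import Literature.NumberTheory.GaloisRepresentations.LocalGaloisGroupFrobeniusProofs
import Summits.Langlands.Langlands.Theorems.SmithKummerSeedCyclicPrimeDescentOfStubs
import HarnessLib.Audit.Status.Attr

/-!
Route: CMFern

Route CMFern — "reciprocity is a CM phenomenon plus ℓ-adic density: over CM fields the infinite fern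
fills the geometric locus and de Rham limits are classical; everything else is ascent/descent
bookkeeping".

It suffices to show X = X₁ ∧ X₂ ∧ X₃ ∧ X₄ where
 X₁ (GeometricFernCM, the PINNED CM CORE — repair rev 7 of FernDensity/ClassicalityOfLimits): for
every CM field F there is ONE reciprocity datum 𝓡 such that (i) [datum pin, (A)-type, no existence
claim] every irreducible ρ : Γ_F → GL_n(ℚ̄_ℓ) whose Frobenius polynomials match a.e. the
L-normalised Satake parameters of a cuspidal L-algebraic π is 𝓡-geometric and Corresponds 𝓡 ι π ρ;
(ii) [THE INFINITE FERN FILLS THE GEOMETRIC LOCUS] every irreducible 𝓡-geometric ρ is, for every m,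
congruent mod ℓ^m at almost all places (spectral norm on Frobenius polynomials) to a Galois
representation ρ_m weakly associated (Satake a.e.) to a REGULAR L-ALGEBRAIC cuspidal π_m of
GL_n(𝔸_F) unramified wherever ρ is away from ℓ (m = 1: a Serre-type conjecture over CM fields; m →
∞: pro-automorphy; no parity obstruction because F is totally complex); (iii) [CLASSICALITY OF
LIMITS] every irreducible 𝓡-geometric such limit is weakly cuspidal-automorphic for an L-algebraic π
of possibly IRREGULAR weight. (i)–(iii) share one ∃𝓡 because the summit's p-adic Hodge data are
placeholder-typed: "𝓡-geometric" is pinned from below only by (A)-type conjuncts and from above only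
by (B)-type conjuncts, so no split into separately quantified items is faithful (the S1 refutation);
the bundle splits into ProAutomorphyCM + ClassicalityCM the day the genuine B_dR / WD∘D_pst
definitions land.
 X₂ (AutToGalCM): direction (A) over CM fields in all weights (shared with LiftDescend) — supplies
the EXISTENCE of irreducible ρ_π with Satake matching, the datum-free core of (A).
 X₃ (AscentConjugationSolvable) and X₄ (AscentResidual): the base-field ascent TR∪CM ⇒
conjugation-solvable ⇒ all fields (shared with BaseFieldAscent).
Datum-free corollary cruxes of X₁, filed because they are where the line is cheaply refutable and
partially provable: AutomorphicFern (every irreducible ρ weakly associated to a cuspidal L-algebraic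
π of ANY weight is such an ℓ-adic limit of regular L-algebraic cuspidal points — the fern passes
through every automorphic point with tame level at S(ρ)) and ClassicalityOfArtinLimits (finite image
+ unramified above ℓ + limit ⇒ weakly automorphic: "Buzzard–Taylor over CM fields").
Theorem-level glue (support): CorrespondentUnique (Satake uniqueness + Chebotarev + Brauer–Nesbitt),
WeakToStrongGalToAut (weak (B) + (A) ⇒ (B) for the same 𝓡), ReciprocityCMtoTR (Sorensen patching for
(A), quadratic descent of automorphy for (B)); needs-fact supports GaloisRepOfRegularAlgebraic,
BorelJacquetDictionary, QuasiCharKernelOpen.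

Lean: CMFern.GeometricFernCM ∧ CMFern.AutToGalCM ∧ CMFern.AscentConjugationSolvable ∧
CMFern.AscentResidual
with "ρ ≡ ρ_m mod ℓ^m a.e." typed as ∀ᶠ v in cofinite, ∃ P Pm, ρ.HasFrobCharpolyAt v P ∧
ρm.HasFrobCharpolyAt v Pm ∧ ∀ i, ‖P.coeff i − Pm.coeff i‖ ≤ ((ℓ:ℝ)^m)⁻¹ (spectral norm on PadicAlgCl
ℓ), "regular L-algebraic" as ∃ T : InfinityType F n, πm.1.HasInfinityType T ∧ T.IsLAlgebraic ∧
T.IsRegular (NOT Clozel's C-normalised IsRegularAlgebraic — S2), "weakly associated" as ∀ᶠ v in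
cofinite, SatakeFrobCompatibleAt ι πm.1 ρm v (datum-free), and "tame level at S(ρ)" as ∀ v, ℓ ∉ v →
ρ.IsUnramifiedAt v → πm.1.IsUnramifiedAt v; constants: Summit.Langlands.{ReciprocityData,
AutomorphicToGalois, GaloisToAutomorphic, Corresponds, IsGeometricFramed, IsConjugate,
SatakeFrobCompatibleAt, GlobalLanglandsCorrespondenceGLn},
Literature.NumberTheory.Automorphic.{CuspidalAutomorphicRepData,
InfinityType(.IsLAlgebraic/.IsRegular),
AutomorphicRepData.HasInfinityType/IsLAlgebraic/IsUnramifiedAt, isCompact_glFiniteIntegralLevel},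
Literature.NumberTheory.GaloisRepresentations.{FramedGaloisRep,
FramedGaloisRep.HasFrobCharpolyAt/IsUnramifiedAt/toLocal, FramedRep.IsLocallyUnramified,
ContinuousRep.IsIrreducible}, Mathlib NumberField.IsCMField, PadicAlgCl, Polynomial.coeff,
Set.Finite.
Assembly (= deciding theorem `closes`, Sketch.lean rc 0, axioms
propext/Classical.choice/Quot.sound): AutToGalCM → GeometricFernCM → CorrespondentUnique →
WeakToStrongGalToAut → ReciprocityCMtoTR → AscentConjugationSolvable → AscentResidual → Langlands.

Rationale: WHY THIS LINE. The p-adic paradigm (Emerton, Calegari–Geraghty, Scholze, the 10-author theorem) is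
the only one that has ever reached beyond polarizable regular representations, and its natural
habitat is a CM field: no real places (so no parity condition: tr ρ(c) is not an obstruction to
being a limit of automorphic representations), Galois representations attached to ALL torsion and
characteristic-0 eigensystems of completed cohomology (Scholze2015), and automorphy lifting in
positive defect (CalegariGeraghty2017, ACCGHLNSTT2023). The paradigm's two global predictions can be
stated EXTERNALLY, with no completed cohomology in the signature: (i) INFINITE FERN — every
geometric ρ is an ℓ-adic limit of regular-cuspidal Galois representations with tame level at S(ρ)
(GL_2/ℚ odd: Gouvêa–Mazur zbl:1134.11324 / Böckle doi:10.1353/ajm.2001.0031 / Emerton2006; unitary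
polarized: Chenevier2011; polarized GL_n: Hellmann–Margerin–Schraen arXiv:1811.09116;
BellaicheChenevier2009 Ch. 7); (ii) CLASSICALITY — a de Rham pro-automorphic point is classical, of
possibly irregular weight (Kisin2009, Emerton, Pan2022; BuzzardTaylor1999 for pro-modular Artin
representations). Even Artin representations and Maass-type objects over ℚ enter after base change
to an imaginary quadratic field, where parity disappears (card bianchi-artin-points) — so the route
bets everything on CM fields and treats TR fields (Sorensen patching + quadratic descent) and all
other fields (route BaseFieldAscent) as bookkeeping. REPAIR (rev 7, 2026-08-15; refuters 96f966f2,
b0baf1eb, g44-61/15/36/18, rattack-1157): the summit's p-adic Hodge data 𝓡.pst are PLACEHOLDER-typed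
(PstWeilDeligneData: abstract period ring + WD relation), so "𝓡-geometric" is only as honest as the
conjuncts quantified together with 𝓡 — (A)-type statements pin the datum from below (too strict ⇒
(A) fails), (B)-type statements pin it from above (too permissive ⇒ (B) fails); the summit is immune
because it is ∃𝓡((A)∧(B)). The old items quantified ∀𝓡 under (A)_𝓡 alone, and a permissive
Kummer-type period ring (making κ∘χ_cyc, κ(1+ℓ)=1+√ℓ, "de Rham") satisfies (A)_𝓡 and kills the fern
at n = 1 (S1); and they paired Clozel's C-normalised IsRegularAlgebraic with the L-normalised Satake
dictionary, unsatisfiable for even n (S2, kernel-checked by rattack-1157: Even n →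
IsRegularAlgebraic → ¬IsLAlgebraic). The repaired core GeometricFernCM therefore carries its own
two-sided pin inside ONE ∃𝓡 — (i) an (A)-type pin WITHOUT existence ("automorphic Galois
representations are 𝓡-geometric and 𝓡-corresponding"), (ii) the fern, (iii) classicality — uses
regular L-ALGEBRAIC approximants, and makes the approximants' Galois match datum-free (Satake a.e.;
their existence for regular π is HLTT/Scholze = support GaloisRepOfRegularAlgebraic up to the C↔L
twist). Every proxy for "geometric" that would let (ii) and (iii) be quantified separately was
checked and fails (NOTES.md §Design: ∀𝓡 forms with any upper pin short of (B) or potential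
automorphy; datum-free proxies die on non-de Rham limit points = non-classical overconvergent
eigenforms of integer weight; ε-Skolemised data are not closable; minimality pins are (B)-hard in
disguise) — except in two honest datum-free sectors, filed as corollary cruxes: automorphic points
(AutomorphicFern) and finite image (ClassicalityOfArtinLimits). Imported area: p-adic geometry of
eigenvarieties/deformation spaces (density), p-adic Hodge theory (classicality); stated over the
summit's API only. Sources: CalegariGeraghty2017, Scholze2015, ACCGHLNSTT2023, Kisin2009, Pan2022,
CaraianiEtAl2016, CalegariEmertonGee2020, Calegari2023, CalegariMazur2008, Acampo2023, Hansen2017,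
Emerton2006, BellaicheChenevier2009, BuzzardTaylor1999, DeligneSerre1974, CalegariVenkatesh2019,
BuzzardGeeLMS2014.

RANKED CRUXES. #2 GeometricFernCM (the pinned CM core: ∃𝓡 [pin ∧ fern fills the 𝓡-geometric locus ∧
classicality of 𝓡-geometric limits]; why it might fail: positive defect l₀ > 0 — automorphic points
are expected sparse/rigid (CalegariMazur2008 Conj. 1.3; Acampo2023: no de Rham deformations of
automorphic points), and classicality at singular weight has no engine beyond GL_2/ℚ weight one
(Pan2022)). #3 AutToGalCM (shared with LiftDescend: (A) over CM in all weights — here it supplies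
the EXISTENCE of irreducible ρ_π with Satake matching; the datum-dependent clauses of (A) for the
core's 𝓡 come from the pin (i)). #4 ClassicalityOfArtinLimits (datum-free Artin sector of (iii):
pro-automorphic finite-image ρ unramified above ℓ are automorphic — "Buzzard–Taylor over CM"; open
off TR fields: no weight-one Bianchi theory; formal corollary of #2 by the datum axiom unramified ⇒
de Rham). #5 AscentConjugationSolvable and #6 AscentResidual (shared with BaseFieldAscent). #7
AutomorphicFern (datum-free corollary of (i)+(ii): the fern passes through EVERY automorphic point —
irregular cuspidal π (weight-one/Artin type, Maass base changes) are ℓ-adic limits of regular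
L-algebraic cuspidal points with tame level at S(ρ); m = 1 = congruences from irregular to regular
eigensystems with no Hasse invariant available over CM; why it might fail: Calegari–Mazur rigidity
of non-CM non-base-change Bianchi families). Support: CorrespondentUnique (new; uniqueness of the
Galois correspondent, theorem-level, rebuilds the uniqueness clause of (A) for the core's 𝓡),
WeakToStrongGalToAut (glue, shared), ReciprocityCMtoTR (theorem-level, shared),
GaloisRepOfRegularAlgebraic / BorelJacquetDictionary / QuasiCharKernelOpen (needs-fact). Assembly
rank 1 = the deciding theorem `closes` (Sketch.lean rc 0, axioms propext / Classical.choice /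
Quot.sound).

KILL CRITERIA. The line now dies datum-free: (a) AutomorphicFern is refutable WITHOUT refuting the
summit — a cuspidal irregular π over an imaginary quadratic F (a base change of a weight-one
newform, a dihedral/tetrahedral Artin-type π via automorphic induction / Langlands–Tunnell over F)
whose Galois representation is provably not congruent mod ℓ, at almost all places, to that of any
regular cuspidal π₁ of level supported on S(ρ)∪{ℓ} (m = 1), or whose ℓ-adic neighbourhood provably
contains no regular cuspidal point of that tame level (m ≥ 2; a Calegari–Mazur-type isolation
theorem for one genuinely-F point), kills #7 and with it #2(ii) via the pin; (b)
ClassicalityOfArtinLimits dies if a finite-image irreducible ρ over a CM field, unramified above ℓ,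
is exhibited as an ℓ-adic limit of regular cuspidal points of tame level S(ρ) but is provably NOT
weakly automorphic (would also contradict the summit); (c) #2 dies with either, or directly if for
the genuine datum a de Rham pro-automorphic non-automorphic ρ is exhibited. A refutation of #2 that
uses a junk datum is impossible by design (the ∃𝓡 is pinned both ways); a refuter who finds one has
found a new typing defect, not a counterexample.

NOT DECOMPOSED YET. (1) #2 is ONE item only because the p-adic Hodge datum is placeholder-typed: the
day the definition items "construct B_dR(K_v)" / "construct WD∘D_pst" (tracked on
Summits/Langlands/Langlands/Statement.lean) land, #2 splits (glued) into ProAutomorphyCM (every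
irreducible GENUINELY de Rham ρ over CM is an ℓ-adic limit of regular L-algebraic cuspidal points,
tame level at S(ρ)) + ClassicalityCM (genuinely de Rham such limits are automorphic) + the pin
becomes a theorem-level support (A'Campo/Varma/Caraiani–Newton-type LGC for automorphic Galois
representations). (2) The internal form (completed cohomology H̃*(K^p)_𝔪 of GL_n/F, "ρ occurs in
𝕋(K^p)", big R = 𝕋 in defect l₀) waits on the completed-cohomology definition request; with it (ii)
splits into (Serre-type residual automorphy over CM) + (R_ρ̄ → 𝕋_𝔪 has the geometric point in its
image) + (local–global compatibility at v∣ℓ for torsion, CaraianiNewton2023), and (iii) into regular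
(10-author + Breuil–Hellmann–Schraen companion points) and singular weight (Pan-type Sen-theoretic
classicality; cards fontaine-operator-order-zero, degenerate-limits-overconvergent). (3) #7 at m = 1
for base-change and CM points is provable now in principle (Hida/Coleman families over ℚ + p-adic
base change on eigenvarieties, Hansen2017; CM families) — left as prover-attached lemmas
(`--supports AutomorphicFern`), not items. The level aspect (fixed tame level N(ρ̄)·cond vs support
only) is deliberately left loose.

CHEAPEST FALSIFIER. m = 1 of AutomorphicFern (#7) for ONE genuinely-Bianchi irregular point: take F
= ℚ(√−3) or ℚ(i), a tetrahedral or octahedral Artin representation ρ of Γ_F that is NOT a twist of a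
base change from ℚ (automorphic over F by Langlands–Tunnell, irregular weight), a prime ℓ ≥ 5
unramified for ρ, and search the regular (parallel weight k ≡ weight-one type mod ℓ−1, k ≤ ℓ+1)
cuspidal Bianchi Hecke eigensystems of level N(ρ)·ℓ^r, r ≤ 2, modulo ℓ for the reduction of ρ's
Frobenius traces at the first ~50 split primes (Bianchi modular symbol / torsion cohomology
computation, cf. arXiv:1106.5749, CalegariVenkatesh2019): absence at all r ≤ 2 and all admissible k
is strong evidence against #7 (and #2), presence is the first non-CM non-base-change data point for
the fern over a CM field. Second cheapest: the n = 1 and n = 2-dihedral cases of #7 and #4, which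
must come out TRUE by CM families (sanity check of the typing; a failure there is a typing defect).

DEFINITION REQUESTS. Genuine p-adic Hodge datum (B_dR(K_v), WD∘D_pst: already tracked by the
Statement's definition items) — needed to split #2; completed cohomology of arithmetic quotients of
GL_n/F (filed at route open) — needed for the internal form.

DEGENERATE CASES CHECKED. n = 1: (i) = local–global class field theory compatibility of the datum,
(ii) trivial (every infinity type of GL_1 is regular; π_m := the algebraic Hecke character of ρ),
(iii) = de Rham characters are automorphic (Weil/Serre) — all true for the genuine datum; m = 0: the
congruence clause is vacuous (integral Frobenius polynomials); even n: approximants are L-algebraic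
regular, the Satake dictionary is the L-normalised one of the Statement (BG Conj. 3.2.1), no C/L
clash (rattack-1157's parity lemma no longer applies); regular ρ = ρ_π: (ii) trivial with π_m := π;
finite-image ρ unramified above ℓ is 𝓡-geometric for EVERY datum (axiom unramified ⇒ de Rham), which
is why #4 is a formal corollary of #2 (Sketch.lean `classicalityOfLimitsR_of_core`, rc 0) and #7 of
#2 via the pin (`fernDensityR_of_core`, rc 0).

Novelty: NOVELTY (survey 2026-08-15). Searches actually run this session: `lit frontier Langlands --since
2021` (read: arXiv:2605.03519 "Infinitesimal characters for the completed cohomology of GL_n over CM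
fields" is the closest live descendant — completed cohomology of GL_n/CM, direction of #2/#4;
arXiv:2603.19768, arXiv:2502.10799 on images/irreducibility), the 13-entry barrier catalogue, `lean
search` over the tree (no completed cohomology, eigenvariety or deformation-ring objects for GL_n
over number fields: cards list them as definition requests; SerreConjecture.lean = Serre over ℚ
only), the in-house cards bianchi-artin-points, kw-ladder-gaussian-field,
serre-count-census-imaginary-quadratic, fontaine-operator-order-zero,
degenerate-limits-overconvergent, newton-bound-as-patching, even-artin-gl4-door,
padic-automorphic-induction (all single-mechanism cards inside this route's cruxes; none states the
external fern crux); `lit search`/`lit vsearch`/`lit galaxy` UNAVAILABLE all session (rc 75 ×3) —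
the refuter must re-run "infinite fern Galois representations density automorphic points",
"pro-modular Fontaine–Mazur classicality completed cohomology CM field", "Serre conjecture imaginary
quadratic fields GL_n", "p-adic approximation of Galois representations by automorphic ones Khare".
Nearest prior art (by id where I have one): Kisin2009 (FM for GL_2 via pro-modularity +
Breuil–Mézard), Pan2022 (residually reducible FM for GL_2/ℚ), CalegariGeraghty2017 §1
(positive-defect patching  [refs: 10.1353/ajm.2001.0031, 10.4310/pamq.2006.v2.n2.a1, 2605.03519, 2603.19768, 2502.10799, 0911.5726, 1811.09116, 1601.03752, 0708.2451, math/0210403, 2008.07099, 2209.06366, 1106.5749, 2301.10509, 2202.14022, doi:10.1353/ajm.2001.0031, doi:10.4310/pamq.2006.v2.n2.a1, Kisin2009, Pan2022, CalegariGeraghty2017, Scholze2015, ACCGHLNSTT2023, CaraianiEtAl2016, CalegariEmertonGee2020, Chenevier2011, Calegar]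

Barriers (technique_class: completed-cohomology eigenvariety p-adic-interpolation): BARRIERS (technique_class: completed-cohomology eigenvariety p-adic-interpolation
automorphy-lifting; all 13 catalogued Langlands entries checked):
- Literature.Barriers.Langlands.NonRegularWeightBarrier: APPLIES to AutToGalCM (irregular π over CM)
and to ClassicalityOfLimits at singular weight (the limit ρ may have repeated Hodge–Tate weights and
the π produced must be non-cohomological); NOT evaded — the route's bet is that classicality at de
Rham points of singular weight follows from Sen-theoretic/locally-analytic methods in completed
cohomology (Pan's weight-one theorem is the one instance), and that FernDensity itself is
INSENSITIVE to the weight of ρ (only the approximants π_m are regular) — the barrier is pushed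
entirely into #4.
- Literature.Barriers.Langlands.ShimuraVarietyRealizationBarrier: APPLIES to any attempt to run
#2–#4 over non-CM fields; evaded by architecture — the p-adic cruxes are stated over CM fields only
(where Scholze's torsion representations live) and every other field is reached through the ascent
cruxes shared with BaseFieldAscent (relocation, not evasion, for the residual insoluble class).
- Literature.Barriers.Langlands.TaylorWilesNumericalCoincidence and
Literature.Barriers.Langlands.TaylorWilesNumericalCoincidenceNarrow: APPLY to
FernDensity/Classicality for non-polarizable ρ over CM (defect l₀ = [F⁺:ℚ]·n(n−1)/2-type > 0): the
fern must fill a locus of positive codimension in deformation space; evasion as far as it goes =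
positive-defect pat

History (route lifecycle, newest last):
- 2026-08-15T16:23:57Z · rev 5: restated GaloisRepOfRegularAlgebraic (stmt-Langlands-2586) — @note_restate.txt (planner-rrepair-Langlands-CMFern-4f48c032-g2-0)
- 2026-08-15T22:13:36Z · rev 7: restated FernDensity (stmt-Langlands-1157), ClassicalityOfLimits (stmt-Langlands-1158), Assembly (stmt-Langlands-1159) — repair rev 7: FernDensity (stmt-Langlands-1157) refuted-misstated — S1 (∀R over placeholder p-adic Hodge data under (A)_R only: a permissive Kummer datum kills (planner-rrefute-Langlands-CMFern-stmt-Langland-5d461fe8-0)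
- 2026-08-26T00:33:28Z · DORMANT — reconciler: no traction for 8.2 d (last activity statement-grounded at 2026-08-17T19:19:49Z); parked, not closed — `ledger route dormant route-Langlands-CMFern (operator:999:2778111)
- 2026-08-29T01:45:50Z · REACTIVATED — reconciler: reactivated — activity statement-checked at 2026-08-28T23:26:51Z after parking at 2026-08-26T00:33:28Z (operator:999:1324648)

sub-problem: Langlands · status: open · opened planner-plan-Langlands-0 2026-08-15T10:52:55Z · rev 8 · ledger route-Langlands-CMFern
GENERATED by the gate from the ledger (D-0016/17). Provers cite these decls: `theorem foo : Summit.Langlands.Langlands.Theses.CMFern.<Decl> := …` in Summits/Langlands/Langlands/Theorems/<Name>.lean.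
-/

namespace Summit.Langlands.Langlands.Theses.CMFern

open scoped BigOperators Topology Manifold Classical MeasureTheory ProbabilityTheory Matrix InnerProductSpace ComplexConjugate ContinuousMap
open Filter Set Function TopologicalSpace MeasureTheory

attribute [summit_statement] _root_.Langlands

/-- item stmt-Langlands-13887 · crux · rank 2 · open · by planner
why it might fail: Positive defect l0>0: automorphic points expected sparse/rigid (CalegariMazur2008 Conj 1.3; Acampo2023: no de Rham deformations), so sporadic regular points may not accumulate ℓ-adically at irregular geometric ρ; (iii) at singular weight has no engine beyond GL_2/Q wt 1 (Pan2022).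
sources: CalegariMazur2008, Acampo2023, Chenevier2011, arXiv:1811.09116, BellaicheChenevier2009, CalegariGeraghty2017
[crux] THE PINNED CM CORE (repair rev 7 of FernDensity, stmt-Langlands-1157, refuted-misstated
S1+S2): for every CM field F there is ONE reciprocity datum R such that (i) [datum pin, (A)-type, no
existence claim] every irreducible ρ : Γ_F → GL_n(ℚ̄_ℓ) whose Frobenius polynomials match a.e. the
L-normalised Satake parameters (m = 1, BG Conj. 3.2.1) of a cuspidal L-algebraic π is R-geometric
and Corresponds R ι π ρ (full local–global compatibility); (ii) [THE INFINITE FERN FILLS THE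
R-GEOMETRIC LOCUS] every irreducible R-geometric ρ is, for every m, congruent mod ℓ^m at almost all
places (spectral norm on Frobenius polynomials) to a Galois representation ρ_m weakly associated
(Satake a.e., datum-free) to a REGULAR L-ALGEBRAIC cuspidal π_m unramified wherever ρ is away from ℓ
(m = 1: Serre-type conjecture over CM fields; m → ∞: pro-automorphy); (iii) [CLASSICALITY OF LIMITS]
every irreducible R-geometric such limit is weakly cuspidal-automorphic for an L-algebraic π of
possibly irregular weight. WHY ONE ITEM: the p-adic Hodge data R.pst are placeholder-typed
(PstWeilDeligneData), so 'R-geometric' is pinned from below only by (A)-type conjuncts ((i); too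
strict a datum fails it) and fr -/
@[route_item "route-Langlands-CMFern", crux]
def GeometricFernCM : Prop :=
  ∀ (F : Type) [Field F] [NumberField F], NumberField.IsCMField F → ∃ R : ReciprocityData F, (∀ (n : ℕ), 0 < n → ∀ (hcpt : Literature.NumberTheory.Automorphic.isCompact_glFiniteIntegralLevel n F) (π : Literature.NumberTheory.Automorphic.CuspidalAutomorphicRepData n F hcpt), π.1.IsLAlgebraic → ∀ (ℓ : ℕ) [Fact ℓ.Prime] (ι : PadicAlgCl ℓ ≃+* ℂ) (ρ : Literature.NumberTheory.GaloisRepresentations.FramedGaloisRep F (PadicAlgCl ℓ) n), ρ.toGaloisRep.IsIrreducible → (∀ᶠ v : IsDedekindDomain.HeightOneSpectrum (NumberField.RingOfIntegers F) in cofinite, SatakeFrobCompatibleAt ι π.1 ρ v) → IsGeometricFramed R ρ ∧ Corresponds R ι π.1 ρ) ∧ (∀ (n : ℕ), 0 < n → ∀ (ℓ : ℕ) [Fact ℓ.Prime] (ι : PadicAlgCl ℓ ≃+* ℂ) (ρ : Literature.NumberTheory.GaloisRepresentations.FramedGaloisRep F (PadicAlgCl ℓ) n), ρ.toGaloisRep.IsIrreducible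 → IsGeometricFramed R ρ → ∀ (m : ℕ) (hcpt : Literature.NumberTheory.Automorphic.isCompact_glFiniteIntegralLevel n F), ∃ (πm : Literature.NumberTheory.Automorphic.CuspidalAutomorphicRepData n F hcpt) (ρm : Literature.NumberTheory.GaloisRepresentations.FramedGaloisRep F (PadicAlgCl ℓ) n), (∃ T : Literature.NumberTheory.Automorphic.InfinityType F n, πm.1.HasInfinityType T ∧ T.IsLAlgebraic ∧ T.IsRegular) ∧ (∀ᶠ v : IsDedekindDomain.HeightOneSpectrum (NumberField.RingOfIntegers F) in cofinite, SatakeFrobCompatibleAt ι πm.1 ρm v) ∧ (∀ v : IsDedekindDomain.HeightOneSpectrum (NumberField.RingOfIntegers F), ((ℓ : ℕ) : NumberField.RingOfIntegers F) ∉ v.asIdeal → ρ.IsUnramifiedAt v → πm.1.IsUnramifiedAt v) ∧ ∀ᶠ v : IsDedekindDomain.HeightOneSpectrum (NumberField.RingOfIntegers F) in cofinite, ∃ P Pm : Polynomial (PadicAlgCl ℓ), ρ.HasFrobCharpolyAt v P ∧ ρm.HasFrobCharpolyAt v Pm ∧ ∀ i : ℕ, ‖P.coeff i - Pm.coeff i‖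 ≤ ((ℓ : ℝ) ^ m)⁻¹) ∧ (∀ (n : ℕ), 0 < n → ∀ (ℓ : ℕ) [Fact ℓ.Prime] (ι : PadicAlgCl ℓ ≃+* ℂ) (ρ : Literature.NumberTheory.GaloisRepresentations.FramedGaloisRep F (PadicAlgCl ℓ) n), ρ.toGaloisRep.IsIrreducible → IsGeometricFramed R ρ → (∀ (m : ℕ) (hcpt : Literature.NumberTheory.Automorphic.isCompact_glFiniteIntegralLevel n F), ∃ (πm : Literature.NumberTheory.Automorphic.CuspidalAutomorphicRepData n F hcpt) (ρm : Literature.NumberTheory.GaloisRepresentations.FramedGaloisRep F (PadicAlgCl ℓ) n), (∃ T : Literature.NumberTheory.Automorphic.InfinityType F n, πm.1.HasInfinityType T ∧ T.IsLAlgebraic ∧ T.IsRegular) ∧ (∀ᶠ v : IsDedekindDomain.HeightOneSpectrum (NumberField.RingOfIntegers F) in cofinite, SatakeFrobCompatibleAt ι πm.1 ρm v) ∧ (∀ v : IsDedekindDomain.HeightOneSpectrum (NumberField.RingOfIntegers F), ((ℓ : ℕ) : NumberField.RingOfIntegers F) ∉ v.asIdeal → ρ.IsUnramifiedAt v → πm.1.IsUnramifiedAt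 v) ∧ ∀ᶠ v : IsDedekindDomain.HeightOneSpectrum (NumberField.RingOfIntegers F) in cofinite, ∃ P Pm : Polynomial (PadicAlgCl ℓ), ρ.HasFrobCharpolyAt v P ∧ ρm.HasFrobCharpolyAt v Pm ∧ ∀ i : ℕ, ‖P.coeff i - Pm.coeff i‖ ≤ ((ℓ : ℝ) ^ m)⁻¹) → ∀ hcpt : Literature.NumberTheory.Automorphic.isCompact_glFiniteIntegralLevel n F, ∃ π : Literature.NumberTheory.Automorphic.CuspidalAutomorphicRepData n F hcpt, π.1.IsLAlgebraic ∧ ∀ᶠ v : IsDedekindDomain.HeightOneSpectrum (NumberField.RingOfIntegers F) in cofinite, SatakeFrobCompatibleAt ι π.1 ρ v)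

/-- item stmt-Langlands-1059 · crux · rank 3 · open · by planner
why it might fail: Irregular L-algebraic π over CM (wt-one type, Maass base changes) have no cohomological/p-adic realisation (NonRegularWeightBarrier); algebraicity of Hecke eigenvalues open (Scholze2015 §1) yet forced by ∀ι; F-ss WD match at v|l and N at v∤l open even for regular π (VarmaFMS2024, Acampo2023).
sources: Scholze2015, HarrisLanTaylorThorneRMS2016, VarmaFMS2024, Acampo2023, Calegari2023, BuzzardGeeLMS2014
[crux] Direction (A) over CM fields F for ALL L-algebraic cuspidal π of GL_n(𝔸_F) (any infinity
type), with the summit's full local–global compatibility: ∃R ∀n>0 ∀hcpt, AutomorphicToGalois n R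
hcpt. Regular algebraic π: HLTT/Scholze (+Varma at v∤ℓ; A'Campo / Caraiani–Newton at v∣ℓ; monodromy
operator open in general). The OPEN CORE is the irregular sector (weight-one type in rank n, base
changes of Maass λ=1/4 forms, abelian-threefold-type weights) where no cohomological/p-adic
realisation is known; every mixed-signature field funnels into it (AscentAutToGal). Shared with
route CMFern. -/
@[route_item "route-Langlands-CMFern", crux]
def AutToGalCM : Prop :=
  ∀ (F : Type) [Field F] [NumberField F], NumberField.IsCMField F → ∃ R : ReciprocityData F, ∀ n : ℕ, 0 < n → ∀ hcpt : Literature.NumberTheory.Automorphic.isCompact_glFiniteIntegralLevel n F, AutomorphicToGalois n R hcpt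

/-- item stmt-Langlands-13888 · crux · rank 4 · open · by planner
why it might fail: No overconvergent-to-classical engine in weight one off TR fields: Bianchi weight-one-type classes are Betti/torsion, not sections of a line bundle (no Hasse/q-expansion gluing, BuzzardTaylor1999); CG l0=1 lifting needs torsion LGC + big residual image (CalegariGeraghty2017 §1).
sources: BuzzardTaylor1999, CalegariGeraghty2017, CalegariVenkatesh2019, DeligneSerre1974, Pan2022, Scholze2015
[crux] CLASSICALITY OF PRO-AUTOMORPHIC ARTIN REPRESENTATIONS OVER CM FIELDS (datum-free repair rev 7
of ClassicalityOfLimits, stmt-Langlands-1158, same S1+S2 defects; 'Buzzard–Taylor over CM'): for F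
CM, an irreducible ρ : Γ_F → GL_n(ℚ̄_ℓ) with FINITE image, unramified a.e. and locally unramified
above ℓ, which is an ℓ-adic limit of regular L-algebraic cuspidal points in the sense of the fern
(for every m: a Galois representation ρ_m Satake-a.e.-associated to a regular L-algebraic cuspidal
π_m unramified wherever ρ is away from ℓ, with Frobenius polynomials ≡ mod ℓ^m a.e.), is weakly
cuspidal-automorphic for an L-algebraic π (of Artin / weight-zero type). Datum-free because finite
image + unramified above ℓ is R-geometric for EVERY datum (PstWeilDeligneData axiom: unramified ⇒ de
Rham), hence a FORMAL corollary of GeometricFernCM (iii) (Sketch.lean classicalityOfLimitsR_of_core,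
rc 0); it is the singular-weight heart of classicality in its cleanest sector and the door for even
Artin representations of ℚ after base change to an imaginary quadratic field (card
bianchi-artin-points). Known: over ℚ/TR (BuzzardTaylor1999 and successors; CalegariGeraghty2017 §1:
minimal weight-one liftin -/
@[route_item "route-Langlands-CMFern"]
def ClassicalityOfArtinLimits : Prop :=
  ∀ (F : Type) [Field F] [NumberField F], NumberField.IsCMField F → ∀ (n : ℕ), 0 < n → ∀ (ℓ : ℕ) [Fact ℓ.Prime] (ι : PadicAlgCl ℓ ≃+* ℂ) (ρ : Literature.NumberTheory.GaloisRepresentations.FramedGaloisRep F (PadicAlgCl ℓ) n), ρ.toGaloisRep.IsIrreducible → (Set.range ρ).Finite → (∀ᶠ v : IsDedekindDomain.HeightOneSpectrum (NumberField.RingOfIntegers F) in cofinite, ρ.IsUnramifiedAt v) → (∀ (v : IsDedekindDomain.HeightOneSpectrum (NumberField.RingOfIntegers F)), ((ℓ : ℕ) : NumberField.RingOfIntegers F) ∈ v.asIdeal → (ρ.toLocal v).IsLocallyUnramified) → (∀ (m : ℕ) (hcpt : Literature.NumberTheory.Automorphic.isCompact_glFiniteIntegralLevel n F), ∃ (πm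 : Literature.NumberTheory.Automorphic.CuspidalAutomorphicRepData n F hcpt) (ρm : Literature.NumberTheory.GaloisRepresentations.FramedGaloisRep F (PadicAlgCl ℓ) n), (∃ T : Literature.NumberTheory.Automorphic.InfinityType F n, πm.1.HasInfinityType T ∧ T.IsLAlgebraic ∧ T.IsRegular) ∧ (∀ᶠ v : IsDedekindDomain.HeightOneSpectrum (NumberField.RingOfIntegers F) in cofinite, SatakeFrobCompatibleAt ι πm.1 ρm v) ∧ (∀ v : IsDedekindDomain.HeightOneSpectrum (NumberField.RingOfIntegers F), ((ℓ : ℕ) : NumberField.RingOfIntegers F) ∉ v.asIdeal → ρ.IsUnramifiedAt v → πm.1.IsUnramifiedAt v) ∧ ∀ᶠ v : IsDedekindDomain.HeightOneSpectrum (NumberField.RingOfIntegers F) in cofinite, ∃ P Pm : Polynomial (PadicAlgCl ℓ), ρ.HasFrobCharpolyAt v P ∧ ρm.HasFrobCharpolyAt v Pm ∧ ∀ i : ℕ, ‖P.coeff i - Pm.coeff i‖ ≤ ((ℓ : ℝ) ^ m)⁻¹) → ∀ hcpt : Literature.NumberTheory.Automorphic.isCompact_glFiniteIntegralLevel n F,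 ∃ π : Literature.NumberTheory.Automorphic.CuspidalAutomorphicRepData n F hcpt, π.1.IsLAlgebraic ∧ ∀ᶠ v : IsDedekindDomain.HeightOneSpectrum (NumberField.RingOfIntegers F) in cofinite, SatakeFrobCompatibleAt ι π.1 ρ v

/-- item stmt-Langlands-1094 · crux · rank 5 · open · by planner
why it might fail: Up-steps cross mixed-signature layers (no Shimura variety): ρ_π must be cut out of ρ_{AI π}|F₁ built from Hodge-irregular induced objects; down-steps along non-normal solvable F/F^tr meet the inert-place twist ambiguity (ArthurClozel Ch.3 end; Rajan MRL 2002 Thm 1-2): known for GL_1, cubic GL_2.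
sources: ArthurClozelAMS120, doi:10.4310/mrl.2002.v9.n4.a9, BoxerEtAl2021, Sorensen2020, HarrisSoudryTaylor1993, Literature.Barriers.Langlands.ShimuraVarietyRealizationBarrier
[crux] Reciprocity over TR∪CM ⇒ reciprocity over every CONJUGATION-SOLVABLE F (typed inline: ∃
totally real F₀ and a finite Galois E ⊇ F ⊇ F₀ with IsSolvable (E ≃ₐ[F₀] E); equivalently the Galois
closure of F over its maximal totally real subfield is solvable — TR, CM, any quadratic extension of
a TR field, pure cubics, every F with [F:F^tr] ≤ 4). Mechanism (card conjugation-solvable-fields,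
T_α): UP-steps along cyclic prime layers by Arthur–Clozel AI/BC (tree: exists_baseChange_cyclic,
ArthurClozel1989_inducedLift_of_twist_eq, _fibres_of_baseChange) + Clifford theory + de-induction
over a Zariski-dense family of twists π⊗χ (Taylor1994, Mok, BCGP §2.7: n=2 any quadratic over TR),
DOWN-steps by cyclic descent (ArthurClozel1989_cuspidal_descent); direction (B) by Jordan–Hölder
matching of isobaric sums across layers using the lower field's reciprocity + AC 4.2(b). The TR∪CM
input is consumed in IRREGULAR weight (strong purity: every induced object over F₁ is
Hodge-irregular). -/
@[route_item "route-Langlands-CMFern", crux]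
def AscentConjugationSolvable : Prop :=
  (∀ (F : Type) [Field F] [NumberField F], (NumberField.IsTotallyReal F ∨ NumberField.IsCMField F) → ∃ R : ReciprocityData F, ∀ n : ℕ, 0 < n → ∀ hcpt : Literature.NumberTheory.Automorphic.isCompact_glFiniteIntegralLevel n F, GlobalLanglandsCorrespondenceGLn n F R hcpt) → ∀ (F : Type) [Field F] [NumberField F], (∃ (F₀ E : Type) (_ : Field F₀) (_ : NumberField F₀) (_ : Field E) (_ : NumberField E) (_ : Algebra F₀ F) (_ : Algebra F E) (_ : Algebra F₀ E) (_ : IsScalarTower F₀ F E) (_ : IsGalois F₀ E), NumberField.IsTotallyReal F₀ ∧ IsSolvable (E ≃ₐ[F₀] E)) → ∃ R : ReciprocityData F, ∀ n : ℕ, 0 < n → ∀ hcpt : Literature.NumberTheory.Automorphic.isCompact_glFiniteIntegralLevel n F, GlobalLanglandsCorrespondenceGLn n F R hcpt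

/-- item stmt-Langlands-1095 · crux · rank 6 · open · by planner
why it might fail: Simple-group base change/automorphic induction/descent for GL_n is beyond every trace-formula comparison in hand (SolvableImageBarrierNarrow; Getz2012Nonsolvable is conditional); open even for n=1 along an A₅-quintic.
sources: Getz2012Nonsolvable, GetzHahn2024, Calegari2023, Literature.Barriers.Langlands.SolvableImageBarrierNarrow
[crux] Reciprocity over all conjugation-solvable fields ⇒ reciprocity over ALL number fields. The
residual class ([F:F^tr] ≥ 5 with insoluble conjugation-closure, e.g. an S₅-quintic with complex
places) is one functoriality away (card T_β): base change + automorphic induction + descent for GL_n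
along Galois extensions with SIMPLE non-abelian group (every finite group has a subnormal series
with cyclic or simple factors), then the same bookkeeping as AscentConjugationSolvable. Typed as the
bare implication; the functoriality hypotheses become separate items once a Literature predicate for
non-cyclic base change / automorphic induction exists (definition request filed with this route). -/
@[route_item "route-Langlands-CMFern", crux]
def AscentResidual : Prop :=
  (∀ (F : Type) [Field F] [NumberField F], (∃ (F₀ E : Type) (_ : Field F₀) (_ : NumberField F₀) (_ : Field E) (_ : NumberField E) (_ : Algebra F₀ F) (_ : Algebra F E) (_ : Algebra F₀ E) (_ : IsScalarTower F₀ F E) (_ : IsGalois F₀ E), NumberField.IsTotallyReal F₀ ∧ IsSolvable (E ≃ₐ[F₀] E)) → ∃ R : ReciprocityData F, ∀ n : ℕ, 0 < n → ∀ hcpt : Literature.NumberTheory.Automorphic.isCompact_glFiniteIntegralLevel n F, GlobalLanglandsCorrespondenceGLn n F R hcpt) → ∀ (F : Type) [Field F] [NumberField F], ∃ R : ReciprocityData F, ∀ n : ℕ, 0 < n → ∀ hcpt : Literature.NumberTheory.Automorphic.isCompact_glFiniteIntegralLevel n F, GlobalLanglandsCorrespondenceGLn n F R hcpt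

/-- item stmt-Langlands-13891 · crux · rank 7 · open · by planner
why it might fail: Genuinely-F irregular points (tetrahedral/octahedral Artin π over F, not base change/CM) may be ℓ-adically isolated from regular classical points of tame level N(ρ): CalegariMazur2008 Conj 1.3; m=1 needs weight-one→regular congruences over F with no Hasse invariant (DeligneSerre1974 is over Q).
sources: CalegariMazur2008, Hansen2017, Emerton2006, BellaicheChenevier2009, DeligneSerre1974, CalegariGeraghty2017
[crux] THE AUTOMORPHIC INFINITE FERN OVER CM FIELDS (datum-free corollary of GeometricFernCM
(i)+(ii), Sketch.lean fernDensityR_of_core rc 0; carries the route's cheapest falsifier): for F CM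
and every cuspidal L-algebraic π of GL_n(𝔸_F) of ANY weight, every irreducible ρ with the
(L-normalised) Satake–Frobenius polynomials of π at almost all places is, for every m, congruent mod
ℓ^m a.e. to a Galois representation Satake-a.e.-associated to a REGULAR L-algebraic cuspidal π_m
unramified wherever ρ is away from ℓ. Regular π: trivial (π_m := π). Content = irregular π: m = 1
says the mod-ℓ Satake eigensystem of an irregular cuspidal π (weight-one / Artin type, base changes
of Maass λ = 1/4 forms) occurs among REGULAR cuspidal eigensystems of level N(ρ)·ℓ^∞ — over ℚ this
is Deligne–Serre × Eisenstein/Hasse (DeligneSerre1974), over an imaginary quadratic field it is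
known only at CM (dihedral) points via CM families and at base-change points via Hida/Coleman
families over ℚ + p-adic base change on eigenvarieties (Hansen2017); m → ∞ says irregular
automorphic points lie in the ℓ-adic closure of the regular ones with tame level at S(ρ) — the
eigenvariety expectation (Emerton2006, Bellaiche -/
@[route_item "route-Langlands-CMFern"]
def AutomorphicFern : Prop :=
  ∀ (F : Type) [Field F] [NumberField F], NumberField.IsCMField F → ∀ (n : ℕ), 0 < n → ∀ (hcpt₀ : Literature.NumberTheory.Automorphic.isCompact_glFiniteIntegralLevel n F) (π : Literature.NumberTheory.Automorphic.CuspidalAutomorphicRepData n F hcpt₀), π.1.IsLAlgebraic → ∀ (ℓ : ℕ) [Fact ℓ.Prime] (ι : PadicAlgCl ℓ ≃+* ℂ) (ρ : Literature.NumberTheory.GaloisRepresentations.FramedGaloisRep F (PadicAlgCl ℓ) n), ρ.toGaloisRep.IsIrreducible → (∀ᶠ v : IsDedekindDomain.HeightOneSpectrum (NumberField.RingOfIntegers F) in cofinite, SatakeFrobCompatibleAt ι π.1 ρ v) → ∀ (m : ℕ) (hcpt : Literature.NumberTheory.Automorphic.isCompact_glFiniteIntegralLevel n F), ∃ (πm :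 Literature.NumberTheory.Automorphic.CuspidalAutomorphicRepData n F hcpt) (ρm : Literature.NumberTheory.GaloisRepresentations.FramedGaloisRep F (PadicAlgCl ℓ) n), (∃ T : Literature.NumberTheory.Automorphic.InfinityType F n, πm.1.HasInfinityType T ∧ T.IsLAlgebraic ∧ T.IsRegular) ∧ (∀ᶠ v : IsDedekindDomain.HeightOneSpectrum (NumberField.RingOfIntegers F) in cofinite, SatakeFrobCompatibleAt ι πm.1 ρm v) ∧ (∀ v : IsDedekindDomain.HeightOneSpectrum (NumberField.RingOfIntegers F), ((ℓ : ℕ) : NumberField.RingOfIntegers F) ∉ v.asIdeal → ρ.IsUnramifiedAt v → πm.1.IsUnramifiedAt v) ∧ ∀ᶠ v : IsDedekindDomain.HeightOneSpectrum (NumberField.RingOfIntegers F) in cofinite, ∃ P Pm : Polynomial (PadicAlgCl ℓ), ρ.HasFrobCharpolyAt v P ∧ ρm.HasFrobCharpolyAt v Pm ∧ ∀ i : ℕ, ‖P.coeff i - Pm.coeff i‖ ≤ ((ℓ : ℝ) ^ m)⁻¹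

/-- item stmt-Langlands-23603 · crux · rank 9 · open · by planner
sources: Henniart1993, HenniartBSMF2002, Shalika1974, HarrisTaylorAMS2001, BuzzardGeeLMS2014
[support] [piece R of the L∤R split; verbatim the registered stub
`…CompatibilityAwayFromLR.Birth.stub_recRigidity`; WEAKER (L∤R forces it: landed
`Theorems/CompatibilityAwayFromLR/Negative/RigidOfCompatibilityAwayFromLR.lean`,
`recGL_eq_of_compatibilityAwayFromLR`); leaf ATTACKABLE closed-mod-print: conclusion of the landed
glue `ReciprocityUpToIrreducibilityR.stub_recRigidityLAlg_of_genericRigidity ∘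
stub_genericRigidity_of_facts` from five local facts (localLanglands_gl, generic preimages, Henniart
2002 Thm 1.7(a) / 1.6(b), invariant measures); critic: CLEARED decomp-langlands-crit-1-g0 0
2026-08-30T01:15:58Z (pub/decomp-langlands/STATUS.md; CRITIC-LEDGER.md row 01:15:58Z)] any two
pinned reciprocity data give the same class rec_v(π_v) to every local component of every L-algebraic
cuspidal π (Henniart's uniqueness of rec_v on generic classes; local components of cusp forms are
generic by Shalika). [difficulty: provable-now] -/
@[route_item "route-Langlands-CMFern", crux]
def RecRigidity : Prop :=
  ∀ (K : Type) [Field K] [NumberField K] (Rec Rec' : ReciprocityData K) (n : ℕ) (hcpt : Literature.NumberTheory.Automorphic.isCompact_glFiniteIntegralLevel n K), 0 < n → ∀ (π : Literature.NumberTheory.Automorphic.CuspidalAutomorphicRepData n K hcpt), π.1.IsLAlgebraic → ∀ (v : IsDedekindDomain.HeightOneSpectrum (NumberField.RingOfIntegers K)) (πv : Literature.NumberTheory.Automorphic.SmoothIrrep (Matrix.GeneralLinearGroup (Fin n) (v.adicCompletion K))), π.1.HasLocalComponentAt v πv.ρ → (Rec.llc v).recGL n (Literature.NumberTheory.Automorphic.IrrClass.mk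 πv) = (Rec'.llc v).recGL n (Literature.NumberTheory.Automorphic.IrrClass.mk πv)

/-- item stmt-Langlands-18032 · support · rank 5 · open · by planner
[crux] ARTHUR–CLOZEL CUSPIDAL DESCENT OF PRIME DEGREE (route-choice 046b9f1f, 2026-08-17: PROMOTION
of the XL-apex Literature fact `Literature.NumberTheory.Automorphic.cuspidal_descent_cyclic`,
VERBATIM with its two predicates IsGaloisStableSatakeAE / IsWeakBaseChangeLiftAE unfolded —
`Iff.rfl` against the fact, planner SketchIff.lean rc 0). For E/F cyclic of prime degree and a
cuspidal Π on GL_n(𝔸_E) (Borel–Jacquet datum CuspidalAutomorphicRepData) whose Satake data are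
Gal(E/F)-stable a.e. (IsGaloisStableSatakeAE, the shadow of Π ≅ Π∘σ, equivalent to it by strong
multiplicity one) there is a cuspidal π on GL_n(𝔸_F) of which Π is a weak base-change lift
(IsWeakBaseChangeLiftAE: t_{Π,w} = t_{π,v}^{f(w|v)} a.e.). Arthur–Clozel 1989 Ch. 3 Thm 4.2 (d),
existence clause (held copy chunk 173; proof chunk 177: 'the identity of (4.1) with (4.2) shows the
existence' = the twisted trace formula comparison, Ch. 2 Thms A–B; no L-function proof of descent is
known). LOAD-BEARING HERE: (i) crux #2 ReciprocityTRCM, line `pieces` (lead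
prover-line-stmt-Langlands-1093-0) — conjunct 1 of the registered stub stub_arthurClozelDescentFacts
and hypothesis 1 of the LANDED stubs stub_quadraticDescentLAlg -/
@[route_item "route-Langlands-CMFern"]
def ArthurClozelCuspidalDescent : Prop :=
  ∀ (n : ℕ) (F E : Type) [Field F] [NumberField F] [Field E] [NumberField E] [Algebra F E] [IsGalois F E] (hF : Literature.NumberTheory.Automorphic.isCompact_glFiniteIntegralLevel n F) (hE : Literature.NumberTheory.Automorphic.isCompact_glFiniteIntegralLevel n E), IsCyclic (E ≃ₐ[F] E) → (Module.finrank F E).Prime → ∀ P : Literature.NumberTheory.Automorphic.CuspidalAutomorphicRepData n E hE, (∀ᶠ w : IsDedekindDomain.HeightOneSpectrum (NumberField.RingOfIntegers E) in Filter.cofinite, ∀ w' : IsDedekindDomain.HeightOneSpectrum (NumberField.RingOfIntegers E), w'.asIdeal.under (NumberField.RingOfIntegers F) = w.asIdeal.under (NumberField.RingOfIntegers F) → ∀ α : Multiset ℂ, P.1.HasSatakeParamAt w α → P.1.HasSatakeParamAt w' α) → ∃ π : Literature.NumberTheory.Automorphic.CuspidalAutomorphicRepData n F hF, ∀ᶠ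 w : IsDedekindDomain.HeightOneSpectrum (NumberField.RingOfIntegers E) in Filter.cofinite, ∀ (v : IsDedekindDomain.HeightOneSpectrum (NumberField.RingOfIntegers F)) (α : Multiset ℂ), w.asIdeal.under (NumberField.RingOfIntegers F) = v.asIdeal → π.1.HasSatakeParamAt v α → P.1.HasSatakeParamAt w (α.map (· ^ w.asIdeal.inertiaDeg (NumberField.RingOfIntegers F)))

/-- item stmt-Langlands-19599 · support · rank 5 · open · by planner
[crux] ARTHUR–CLOZEL CUSPIDAL BASE CHANGE OF PRIME DEGREE (route-choice rchoice 2f2042a4,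
2026-08-17: PROMOTION of the XL-apex Literature fact
`Literature.NumberTheory.Automorphic.baseChange_cyclic_cuspidal`, VERBATIM and fully qualified,
`IsWeakBaseChangeLiftAE` unfolded by its Iff.rfl lemma — Iff.rfl against the fact, planner
SketchIff.lean rc 0, #h21_crux_probe CLEAN). For E/F Galois of PRIME degree l (hence cyclic) and a
cuspidal π on GL_n(𝔸_F) with ONE place v inert in E (w ∣ v of residue degree l) and a Satake
parameter α at v with ζ•α ≠ α for every primitive l-th root of unity ζ (local shadow of the printed
π ≇ π⊗η: t_{π⊗η,v} = η(ϖ_v)·t_{π,v}, η(ϖ_v) primitive at inert v, AC proof of Thm 3.1) there is, for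
every level datum hE, a CUSPIDAL P on GL_n(𝔸_E) which is a weak base-change lift of π (t_{P,w} =
t_{π,v}^{f(w|v)} a.e.). Arthur–Clozel 1989 Ch. 3 Thm 4.2 (a) with Def. 1.1 (held copy p0173 L13–15:
'(a) Assume π is cuspidal, π ≢ π⊗η. Then there is a unique σ-stable Π lifting π; Π is cuspidal';
proof p0174 L25–p0176 = twisted trace formula comparison (4.1)=(4.2); n = 2 is Langlands 1980).
LOAD-BEARING HERE: the UP-step of crux AscentConjugationSolvable (stmt-Langlands-1094; -/
@[route_item "route-Langlands-CMFern"]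
def ArthurClozelCuspidalBaseChange : Prop :=
  ∀ (n : ℕ) (F E : Type) [Field F] [NumberField F] [Field E] [NumberField E] [Algebra F E] [IsGalois F E], (Module.finrank F E).Prime → ∀ (hF : Literature.NumberTheory.Automorphic.isCompact_glFiniteIntegralLevel n F) (π : Literature.NumberTheory.Automorphic.CuspidalAutomorphicRepData n F hF), (∃ (v : IsDedekindDomain.HeightOneSpectrum (NumberField.RingOfIntegers F)) (w : IsDedekindDomain.HeightOneSpectrum (NumberField.RingOfIntegers E)) (α : Multiset ℂ), w.asIdeal.under (NumberField.RingOfIntegers F) = v.asIdeal ∧ w.asIdeal.inertiaDeg (NumberField.RingOfIntegers F) = Module.finrank F E ∧ π.1.HasSatakeParamAt v α ∧ ∀ ζ : ℂ, IsPrimitiveRoot ζ (Module.finrank F E) → α.map (ζ * ·) ≠ α) → ∀ (hE : Literature.NumberTheory.Automorphic.isCompact_glFiniteIntegralLevel n E), ∃ P : Literature.NumberTheory.Automorphic.CuspidalAutomorphicRepData n E hE, ∀ᶠ w : IsDedekindDomain.HeightOneSpectrum (NumberField.RingOfIntegers E) in Filter.cofinite, ∀ (v : IsDedekindDomain.HeightOneSpectrum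 (NumberField.RingOfIntegers F)) (α : Multiset ℂ), w.asIdeal.under (NumberField.RingOfIntegers F) = v.asIdeal → π.1.HasSatakeParamAt v α → P.1.HasSatakeParamAt w (α.map (· ^ w.asIdeal.inertiaDeg (NumberField.RingOfIntegers F)))

/-- item stmt-Langlands-10478 · support · rank 9 · closed · proved by Summit.Langlands.Langlands.Theorems.liftDescend_quasiCharKernelOpen_proof (prover) · by planner
[support] needs-fact (route-repair g4 2026-08-15, cone guardrail; audit alias): the named fact
`Literature.NumberTheory.Automorphic.isOpen_ker_quasiChar` (quasi-characters of Fˣ have open kernel;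
BushnellHenniart2006 §1.5) is a field (`hqc`) of every `LocalLanglandsDatum`, hence of every
`ReciprocityData F` the route's items quantify over. It is DISCHARGED in tree
(`isOpen_ker_quasiChar_holds`, LocalLanglandsGLProofs.lean:367, now imported by this route file) but
the gate's cone audit (`#h21_route_deps`, H21.Audit.statesExactly) does not see the witness: its
binders are `[Field F] [ValuativeRel F] [TopologicalSpace F]` while the def's are `[Field F]
[TopologicalSpace F] [ValuativeRel F]`, so the fact still counts in deps.unproved (2 left: this and
exists_galoisRep_of_regularAlgebraic). DELIVERABLE for whoever takes this item: (1) the one-line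
Literature alias, proposed into Literature/NumberTheory/Automorphic/LocalLanglandsGLProofs.lean
(namespace Literature.NumberTheory.Automorphic): `theorem isOpen_ker_quasiChar.holds {F : Type*}
[Field F] [TopologicalSpace F] [ValuativeRel F] [IsNonarchimedeanLocalField F] :
isOpen_ker_quasiChar (F := F) := isOpen_ker_quasiChar_holds` (verified -/
@[route_item "route-Langlands-CMFern"]
def QuasiCharKernelOpen : Prop :=
  ∀ (F : Type) [Field F] [TopologicalSpace F] [ValuativeRel F] [IsNonarchimedeanLocalField F], Literature.NumberTheory.Automorphic.isOpen_ker_quasiChar (F := F)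

-- `QuasiCharKernelOpen` holds: proved by `Summit.Langlands.Langlands.Theorems.liftDescend_quasiCharKernelOpen_proof` (its module imports this route file, so no `_holds` link can be stated here).

/-- item stmt-Langlands-1065 · support · rank 9 · closed · proved by Summit.Langlands.Langlands.Theorems.SmithKummerSeedCyclicPrimeDescent.weakToStrongGalToAut_proof (prover) · by planner
sources: BuzzardGeeLMS2014, SerreAbelianLadic1968
[support] Glue: given (A) w.r.t. R and weak (B) (a.e. SatakeFrobCompatibleAt), deduce
GaloisToAutomorphic w.r.t. the same R — ρ and ρ_π are irreducible with equal Frobenius polynomials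
a.e. (uniqueness of Satake parameters) ⇒ conjugate (Chebotarev density + Brauer–Nesbitt) ⇒ transport
Corresponds along FramedRep.conj (isUnramifiedAt_conj_iff, charpoly invariance,
PstWeilDeligneData.conj, class-level HasFrobSemisimpleClass). Provable now modulo a
Chebotarev-density named fact for ℓ-adic representations. -/
@[route_item "route-Langlands-CMFern", crux]
def WeakToStrongGalToAut : Prop :=
  ∀ (F : Type) [Field F] [NumberField F] (R : ReciprocityData F), (∀ n : ℕ, 0 < n → ∀ hcpt : Literature.NumberTheory.Automorphic.isCompact_glFiniteIntegralLevel n F, AutomorphicToGalois n R hcpt) → (∀ (n : ℕ), 0 < n → ∀ (ℓ : ℕ) [Fact ℓ.Prime] (ι : PadicAlgCl ℓ ≃+* ℂ) (ρ : Literature.NumberTheory.GaloisRepresentations.FramedGaloisRep F (PadicAlgCl ℓ) n), ρ.toGaloisRep.IsIrreducible → IsGeometricFramed R ρ → ∀ hcpt : Literature.NumberTheory.Automorphic.isCompact_glFiniteIntegralLevel n F, ∃ π : Literature.NumberTheory.Automorphic.CuspidalAutomorphicRepData n F hcpt, π.1.IsLAlgebraic ∧ ∀ᶠ v : IsDedekindDomain.HeightOneSpectrum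 (NumberField.RingOfIntegers F) in cofinite, SatakeFrobCompatibleAt ι π.1 ρ v) → ∀ n : ℕ, 0 < n → ∀ hcpt : Literature.NumberTheory.Automorphic.isCompact_glFiniteIntegralLevel n F, GaloisToAutomorphic n R hcpt

/-- `WeakToStrongGalToAut` holds: proved by `Summit.Langlands.Langlands.Theorems.SmithKummerSeedCyclicPrimeDescent.weakToStrongGalToAut_proof`. -/
theorem WeakToStrongGalToAut_holds : WeakToStrongGalToAut := _root_.Summit.Langlands.Langlands.Theorems.SmithKummerSeedCyclicPrimeDescent.weakToStrongGalToAut_proof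

-- earlier GaloisRepOfRegularAlgebraic (stmt-Langlands-2586, replaced 2026-08-15T16:23:57Z -> stmt-Langlands-10785): open — Literature.NumberTheory.Automorphic.exists_galoisRep_of_regularAlgebraic
/-- item stmt-Langlands-10785 · support · rank 9 · open · by planner
[support] needs-fact: Literature.NumberTheory.Automorphic.exists_galoisRep_of_regularAlgebraic
(lang.S27 = HarrisLanTaylorThorneRMS2016 Thm A + Scholze2015 Cor V.4.2 + VarmaFMS2024 Thm 1: Galois
representations attached to REGULAR algebraic cuspidal π of GL_n over totally real / CM K,
unramified and Satake–Frobenius compatible at every unramified v ∤ ℓ, C-normalisation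
`arithFrobPolyOfSatake ι q_v n α`). RESTATED INLINE (route-repair g2, 2026-08-15): the item is now
the fact's statement VERBATIM with explicit binders instead of an alias of the Literature constant,
so the named fact is this route's OWN recorded obligation (cone rule: own items excepted) rather
than a cite_only constant in the dependency cone that would keep the whole route unstaffable until
HLTT is a Lean theorem. It is definitionally equivalent to the Literature fact (Sketch.lean
`galoisRepOfRegularAlgebraic_iff`, rc 0): the day `exists_galoisRep_of_regularAlgebraic_holds` lands
in Literature this item closes in one line (`fun n K _ _ hcpt =>
exists_galoisRep_of_regularAlgebraic_holds hcpt`); until then it is the regular-weight sector of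
AutToGalCM (rank 3) and the source of the branches ρ_{π_m} of FernDensity (ran -/
@[route_item "route-Langlands-CMFern"]
def GaloisRepOfRegularAlgebraic : Prop :=
  ∀ (n : ℕ) (K : Type) [Field K] [NumberField K] (hcpt : Literature.NumberTheory.Automorphic.isCompact_glFiniteIntegralLevel n K), (NumberField.IsTotallyReal K ∨ NumberField.IsCMField K) → ∀ (π : Literature.NumberTheory.Automorphic.CuspidalAutomorphicRepData n K hcpt), π.1.IsRegularAlgebraic → ∀ (ℓ : ℕ) [Fact ℓ.Prime] (ι : PadicAlgCl ℓ ≃+* ℂ), ∃ r : Literature.NumberTheory.GaloisRepresentations.FramedGaloisRep K (PadicAlgCl ℓ) n, r.toGaloisRep.IsSemisimple ∧ ∀ (v : IsDedekindDomain.HeightOneSpectrum (NumberField.RingOfIntegers K)) (α : Multiset ℂ), π.1.HasSatakeParamAt v α → ((ℓ : ℕ) : NumberField.RingOfIntegers K) ∉ v.asIdeal → r.IsUnramifiedAt v ∧ r.HasFrobCharpolyAt v (Literature.NumberTheory.Automorphic.arithFrobPolyOfSatake ι v.residueCard n α)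

/-- item stmt-Langlands-1096 · support · rank 9 · open · by planner
sources: Sorensen2020, ArthurClozelAMS120, BarnetlambEtAl2014
[support] Reciprocity over all CM fields ⇒ over all totally real fields: (A) by Sorensen patching
over the S-general family of imaginary-quadratic composita FK_i (π ↦ BC_{FK_i/F}(π) cuspidal for all
but finitely many K_i; ρ_i from (A) over FK_i; tree PatchingLemma/SorensenPatching; LGC and de
Rhamness transferred from a K_i splitting v); (B) by quadratic descent of automorphy given (A) over
F (choose K with ρ|_{FK} irreducible — all but finitely many — then Π^c≅Π ⇒ Π = BC(π) by
Arthur–Clozel ⇒ ρ ≅ ρ_π⊗χ). Theorem-level; shared with route CMFern. -/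
@[route_item "route-Langlands-CMFern", crux]
def ReciprocityCMtoTR : Prop :=
  (∀ (F : Type) [Field F] [NumberField F], NumberField.IsCMField F → ∃ R : ReciprocityData F, ∀ n : ℕ, 0 < n → ∀ hcpt : Literature.NumberTheory.Automorphic.isCompact_glFiniteIntegralLevel n F, GlobalLanglandsCorrespondenceGLn n F R hcpt) → ∀ (F : Type) [Field F] [NumberField F], NumberField.IsTotallyReal F → ∃ R : ReciprocityData F, ∀ n : ℕ, 0 < n → ∀ hcpt : Literature.NumberTheory.Automorphic.isCompact_glFiniteIntegralLevel n F, GlobalLanglandsCorrespondenceGLn n F R hcpt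

/-- item stmt-Langlands-13902 · support · rank 9 · closed · proved by Summit.Langlands.Langlands.Theorems.cmFern_correspondentUnique_proof (prover) · by planner
sources: SerreAbelianLadic1968, BuzzardGeeLMS2014
[support] UNIQUENESS OF THE GALOIS CORRESPONDENT, datum-free (new, repair rev 7): if ρ is
irreducible and ρ, ρ' both match the Satake parameters of the same cuspidal π at almost all places
(L-normalised, m = 1), then ρ' is GL_n(ℚ̄_ℓ)-conjugate to ρ — uniqueness of Satake parameters (tree:
AutomorphicRepData.hasSatakeParamAt_unique_holds) + Chebotarev density + Brauer–Nesbitt (tree: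
FramedGaloisRep.nonempty_equiv_of_hasFrobCharpolyAt_eventually) + 'a representation with irreducible
semisimplification is irreducible'. Theorem-level, provable now modulo the Chebotarev named fact;
same engine as WeakToStrongGalToAut (stmt-Langlands-1065). Used by `closes` to rebuild the
uniqueness clause of (A) for the pinned datum of GeometricFernCM. [difficulty: provable-now] -/
@[route_item "route-Langlands-CMFern", crux]
def CorrespondentUnique : Prop :=
  ∀ (F : Type) [Field F] [NumberField F] (n : ℕ), 0 < n → ∀ (hcpt : Literature.NumberTheory.Automorphic.isCompact_glFiniteIntegralLevel n F) (π : Literature.NumberTheory.Automorphic.CuspidalAutomorphicRepData n F hcpt) (ℓ : ℕ) [Fact ℓ.Prime] (ι : PadicAlgCl ℓ ≃+* ℂ) (ρ ρ' : Literature.NumberTheory.GaloisRepresentations.FramedGaloisRep F (PadicAlgCl ℓ) n), ρ.toGaloisRep.IsIrreducible → (∀ᶠ v : IsDedekindDomain.HeightOneSpectrum (NumberField.RingOfIntegers F) in cofinite, SatakeFrobCompatibleAt ι π.1 ρ v) → (∀ᶠ v : IsDedekindDomain.HeightOneSpectrum (NumberField.RingOfIntegers F) in cofinite, SatakeFrobCompatibleAt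 ι π.1 ρ' v) → IsConjugate ρ ρ'

-- `CorrespondentUnique` holds: proved by `Summit.Langlands.Langlands.Theorems.cmFern_correspondentUnique_proof` (its module imports this route file, so no `_holds` link can be stated here).

/-- item stmt-Langlands-18101 · support · rank 9 · open · by planner
[support] DATUM INDEPENDENCE of the summit's correspondence predicate — the exact price, for this
route, of the statement revision p141787 (2026-08-17: `Langlands := ∀ F, Nonempty (ReciprocityData
F) ∧ ∀ Rec n, 0 < n → ∀ hcpt, GLC n F Rec hcpt`, reciprocity data PINNED to the canonical local
Artin maps by `llc_isCanonical` / `llc_eps_isCanonical`): for every number field F, any two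
reciprocity data Rec, Rec′, every n ≥ 1, hcpt, cuspidal π of GL_n(𝔸_F), ℓ, ι : ℚ̄_ℓ ≃ ℂ and framed ρ
: Γ_F → GL_n(ℚ̄_ℓ), `Corresponds Rec ι π ρ → Corresponds Rec′ ι π ρ`. Verbatim (full names, binders
Rec/Rec′) the `DatumIndependence` of Cruxes/ReciprocityUpToIrreducibilityR/SketchIdeateR1K2.lean
(idea henniart-rigidity-forall-rec, crux stmt-Langlands-17925's PICKED line), where it is DERIVED
sorry-free (`datumIndependence_of_genericRigidity ∘ genericRigidity_of_local`) from HENNIART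
RIGIDITY ON GENERIC CLASSES (`LocalGenericRigidity`: two local Langlands data over F_v with
canonical Artin pins agree on every generic class — Henniart1993 Thm 1.1 = the tree's named fact
localLanglands_gl, uniqueness half, on supercuspidals, + localEpsilonSystem_unique
(DeligneAntwerpII1973 Thm 4.1) + Henniart2002 Thm 1.7/ -/
@[route_item "route-Langlands-CMFern"]
def DatumIndependence : Prop :=
  ∀ (F : Type) [Field F] [NumberField F] (Rec Rec' : ReciprocityData F) (n : ℕ), 0 < n → ∀ (hcpt : Literature.NumberTheory.Automorphic.isCompact_glFiniteIntegralLevel n F) (π : Literature.NumberTheory.Automorphic.CuspidalAutomorphicRepData n F hcpt) (ℓ : ℕ) [Fact ℓ.Prime] (ι : PadicAlgCl ℓ ≃+* ℂ) (ρ : Literature.NumberTheory.GaloisRepresentations.FramedGaloisRep F (PadicAlgCl ℓ) n), Corresponds Rec ι π.1 ρ → Corresponds Rec' ι π.1 ρ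

/-- item stmt-Langlands-2607 · support · rank 9 · open · by planner
[support] needs-fact ×4 (route-repair 2026-08-15, cone guardrail): the Borel–Jacquet §4.3–4.6
dictionary for GL_n over every number field K, bundling at the GL_n automorphy datum the four cone
facts route CMFern genuinely rests on —
`Literature.NumberTheory.Automorphic.automorphicForms_isStableSubmodule` (BJ 4.3: the space of
automorphic forms is a (𝔤,K_∞)×G(𝔸_f)-module; needed to build a CuspidalAutomorphicRepData from a
classical eigenform, i.e. by every direction-(B) construction such as ClassicalityOfLimits, rank 4)
and, for every automorphic measure μ,
`Literature.NumberTheory.Automorphic.AutomorphicRepsGL.exists_isAssociatedL2`,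
`Literature.NumberTheory.Automorphic.AutomorphicRepsGL.exists_cuspidalRepData_of_L2`,
`Literature.NumberTheory.Automorphic.hasSatakeParamAt_iff_L2` (BJ 4.4–4.6: (𝔤,K)-module ↔ L²_cusp
bridges and agreement of Satake parameters — exactly the hypotheses hA/hAss/hL2 of the RepData
base-change and cyclic-descent theorems ArthurClozelFibresRepData / CuspidalDescentCyclicRepData on
which AscentConjugationSolvable (rank 5) and ReciprocityCMtoTR run). Source: BorelJacquet1979
§4.3–4.6 (Harish-Chandra, Gelfand–Piatetski-Shapiro). Tier-0 cone debt: closes by th -/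
@[route_item "route-Langlands-CMFern"]
def BorelJacquetDictionary : Prop :=
  ∀ (n : ℕ) (K : Type) [Field K] [NumberField K] (hcpt : Literature.NumberTheory.Automorphic.isCompact_glFiniteIntegralLevel n K), Literature.NumberTheory.Automorphic.automorphicForms_isStableSubmodule (Literature.NumberTheory.Automorphic.AutomorphyDatum.gl n K hcpt) ∧ ∀ (μ : MeasureTheory.Measure (Literature.NumberTheory.Automorphic.AdelicGroupData.gl n K).automorphicQuotient) [(Literature.NumberTheory.Automorphic.AdelicGroupData.gl n K).IsAutomorphicMeasure μ], Literature.NumberTheory.Automorphic.AutomorphicRepsGL.exists_isAssociatedL2 hcpt μ ∧ Literature.NumberTheory.Automorphic.AutomorphicRepsGL.exists_cuspidalRepData_of_L2 hcpt μ ∧ Literature.NumberTheory.Automorphic.hasSatakeParamAt_iff_L2 hcpt μ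

-- earlier Assembly (stmt-Langlands-1159, replaced 2026-08-15T22:13:36Z -> stmt-Langlands-13890): retired by None — AutToGalCM → FernDensity → ClassicalityOfLimits → WeakToStrongGalToAut → ReciprocityCMtoTR → AscentConjugationSolvable → AscentResidual → Langlands
/-- item stmt-Langlands-13890 · assembly · rank 1 · open · by planner
sources: BuzzardGeeLMS2014
[assembly] AutToGalCM → GeometricFernCM → CorrespondentUnique → WeakToStrongGalToAut →
ReciprocityCMtoTR → AscentConjugationSolvable → AscentResidual → Langlands. Pure logic (= the
deciding theorem `closes`, repair rev 7; Sketch.lean rc 0, axioms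
propext/Classical.choice/Quot.sound): for CM F take R from GeometricFernCM; (A)_R from the
irreducible Satake-matching ρ_π of AutToGalCM's own datum (datum-free clause of Corresponds) + pin
(i) + CorrespondentUnique; weak (B)_R from (ii)+(iii); WeakToStrongGalToAut gives (B)_R, hence the
summit over CM; ReciprocityCMtoTR gives TR; the two ascents give all F. -/
@[route_item "route-Langlands-CMFern"]
def Assembly : Prop :=
  AutToGalCM → GeometricFernCM → CorrespondentUnique → WeakToStrongGalToAut → ReciprocityCMtoTR → AscentConjugationSolvable → AscentResidual → Langlands

-- records of items no longer active in this route (dropped / restated):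
-- earlier FernDensity (stmt-Langlands-1157, replaced 2026-08-15T22:13:36Z -> stmt-Langlands-13887): retired by None — ∀ (F : Type) [Field F] [NumberField F] (R : ReciprocityData F), NumberField.IsCMField F → (∀ n : ℕ, 0 < n → ∀ hcpt : Literature.NumberTheory.Automorphic.isCompact_glFiniteIntegralLevel n F, AutomorphicToGalois n R hcpt) → ∀ (n : ℕ), 0 < n → ∀ (ℓ : ℕ) [Fact ℓ.Prime] (ι : PadicAlgCl ℓ 
-- earlier ClassicalityOfLimits (stmt-Langlands-1158, replaced 2026-08-15T22:13:36Z -> stmt-Langlands-13888): retired by None — ∀ (F : Type) [Field F] [NumberField F] (R : ReciprocityData F), NumberField.IsCMField F → (∀ n : ℕ, 0 < n → ∀ hcpt : Literature.NumberTheory.Automorphic.isCompact_glFiniteIntegralLevel n F, AutomorphicToGalois n R hcpt) → ∀ (n : ℕ), 0 < n → ∀ (ℓ : ℕ) [Fact ℓ.Prime] (ι : Padi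

/-! D-0027 §2.1 — DECIDING THEOREM (planner-authored via `route open/edit --closes-file`; by operator:999:3651741 2026-08-31T08:07:15Z):
its hypotheses are this route's items and its conclusion the sub-problem Statement (glue_lint), and it elaborates with this file. -/

/-- D-0027 §2.1 deciding theorem of route CMFern — REPAIRED 2026-08-31 against the summit as re-typed
2026-08-16 (`∀ F, Nonempty (ReciprocityData F) ∧ ∀ 𝓡 n, 0 < n → ∀ hcpt, (A) ∧ (B)`; the rev-7-era text
ended in `hRes (hCS hTRCM) F : ∃ R, …` and no longer elaborated, L506). Pure logic over the seven
load-bearing items plus the shared support item `RecRigidity` (= stmt-Langlands-23603): reciprocity over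
every CM field for ONE pinned datum `R` — (A) from `AutToGalCM`, re-pinned to the datum of
`GeometricFernCM` (geometricity + full compatibility of Satake-matching irreducible `ρ`), uniqueness by
`CorrespondentUnique`, (B) from the geometric Fern (pro-automorphy + classicality) upgraded by
`WeakToStrongGalToAut`; then totally real fields (`ReciprocityCMtoTR`), conjugation-solvable fields
(`AscentConjugationSolvable`) and all number fields (`AscentResidual`) — one-datum reciprocity for every
`F`, whence `Nonempty (ReciprocityData F)`; TRANSFER to EVERY pinned datum along `RecRigidity` (any two
pinned data give the same class to every local component of every L-algebraic cuspidal `π`):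
`IsGeometricFramed` and the `v ∣ ℓ` clause read the pinned Fontaine datum (definitional agreement), the
Satake clause is datum-free, the rec-class clause is rewritten in both directions (so the uniqueness
clause of (A) transfers too). Only Statement-level definitions are unfolded; no new import. The support
items `QuasiCharKernelOpen`, `GaloisRepOfRegularAlgebraic`, `BorelJacquetDictionary`,
`ClassicalityOfArtinLimits`, `AutomorphicFern` and the bookkeeping `Assembly` are not hypotheses. -/
@[closes "route-Langlands-CMFern"] theorem closes (hA : AutToGalCM) (hCore : GeometricFernCM) (hU : CorrespondentUnique)
    (hWS : WeakToStrongGalToAut) (hTR : ReciprocityCMtoTR) (hCS : AscentConjugationSolvable)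
    (hRes : AscentResidual) (hRR : RecRigidity) : _root_.Langlands := by
  -- reciprocity over every CM field
  have hCM : ∀ (F : Type) [Field F] [NumberField F], NumberField.IsCMField F →
      ∃ R : ReciprocityData F, ∀ n : ℕ, 0 < n →
        ∀ hcpt : Literature.NumberTheory.Automorphic.isCompact_glFiniteIntegralLevel n F,
          GlobalLanglandsCorrespondenceGLn n F R hcpt := by
    intro F _ _ hF
    obtain ⟨R₀, hA0⟩ := hA F hF
    obtain ⟨R, hPin, hPro, hCl⟩ := hCore F hF
    -- direction (A) for the pinned datum R
    have hAR : ∀ n : ℕ, 0 < n →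
        ∀ hcpt : Literature.NumberTheory.Automorphic.isCompact_glFiniteIntegralLevel n F,
          AutomorphicToGalois n R hcpt := by
      intro n hn hcpt π hL ℓ _ ι
      obtain ⟨ρ, hirr, -, hcorr, -⟩ := hA0 n hn hcpt π hL ℓ ι
      obtain ⟨hgeom, hcorrR⟩ := hPin n hn hcpt π hL ℓ ι ρ hirr hcorr.1
      exact ⟨ρ, hirr, hgeom, hcorrR, fun ρ' h' => hU F n hn hcpt π ℓ ι ρ ρ' hirr hcorr.1 h'.1⟩
    refine ⟨R, fun n hn hcpt => ⟨hAR n hn hcpt, ?_⟩⟩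
    refine hWS F R hAR ?_ n hn hcpt
    intro n hn ℓ _ ι ρ hirr hgeom hcpt
    exact hCl n hn ℓ ι ρ hirr hgeom (hPro n hn ℓ ι ρ hirr hgeom) hcpt
  -- totally real ∪ CM
  have hTRCM : ∀ (F : Type) [Field F] [NumberField F],
      (NumberField.IsTotallyReal F ∨ NumberField.IsCMField F) →
      ∃ R : ReciprocityData F, ∀ n : ℕ, 0 < n →
        ∀ hcpt : Literature.NumberTheory.Automorphic.isCompact_glFiniteIntegralLevel n F,
          GlobalLanglandsCorrespondenceGLn n F R hcpt := by
    intro F _ _ h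
    rcases h with h | h
    · exact hTR hCM F h
    · exact hCM F h
  -- conjugation-solvable, then all number fields: one-datum reciprocity for `F`
  intro F _ _
  obtain ⟨R, hR⟩ := hRes (hCS hTRCM) F
  refine ⟨⟨R⟩, fun Rec n hn hcpt => ?_⟩
  -- TRANSFER from the one datum `R` to the arbitrary pinned datum `Rec` along `RecRigidity`:
  -- `IsGeometricFramed` and the `v ∣ ℓ` clause read the pinned Fontaine datum (`ReciprocityData.pst`
  -- ignores its argument ⇒ definitional agreement), the Satake clause is datum-free, and the one
  -- datum-dependent clause `rℂ.HasFrobSemisimpleClass (rec_v π_v)` is rewritten along `RecRigidity`.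
  have hcorrT : ∀ (R₁ R₂ : ReciprocityData F) (ℓ : ℕ) [Fact ℓ.Prime] (ι : PadicAlgCl ℓ ≃+* ℂ)
      (π : Literature.NumberTheory.Automorphic.CuspidalAutomorphicRepData n F hcpt), π.1.IsLAlgebraic →
      ∀ ρ : Literature.NumberTheory.GaloisRepresentations.FramedGaloisRep F (PadicAlgCl ℓ) n,
        Corresponds R₁ ι π.1 ρ → Corresponds R₂ ι π.1 ρ := by
    intro R₁ R₂ ℓ _ ι π hπ ρ h
    refine ⟨h.1, fun v => ?_⟩
    obtain ⟨πv, r, rℂ, hloc, haway, habove, htrans, hclass⟩ := h.2 v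
    refine ⟨πv, r, rℂ, hloc, haway, habove, htrans, ?_⟩
    rw [← hRR F R₁ R₂ n hcpt hn π hπ v πv hloc]
    exact hclass
  obtain ⟨hA, hB⟩ := hR n hn hcpt
  refine ⟨?_, ?_⟩
  · -- (A) for `Rec`
    intro π hπ ℓ _ ι
    obtain ⟨ρ, hirr, hgeo, hcorr, huniq⟩ := hA π hπ ℓ ι
    exact ⟨ρ, hirr, hgeo, hcorrT R Rec ℓ ι π hπ ρ hcorr,
      fun ρ' h' => huniq ρ' (hcorrT Rec R ℓ ι π hπ ρ' h')⟩
  · -- (B) for `Rec`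
    intro ℓ _ ι ρ hirr hgeo
    obtain ⟨π, hπ, hcorr⟩ := hB ℓ ι ρ hirr hgeo
    exact ⟨π, hπ, hcorrT R Rec ℓ ι π hπ ρ hcorr⟩

end Summit.Langlands.Langlands.Theses.CMFern
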